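import Literature.MathematicalPhysics.QuantumLattice.FermionicTreeExpansionDecay
import Mathlib.Analysis.InnerProductSpace.PiL2
import HarnessLib

/-!
# The tree bound for a general bounded propagator (fixed-order form)

Topic `Literature/MathematicalPhysics/QuantumLattice`; a complement to
`FermionicTreeExpansionTrees.lean` / `FermionicTreeExpansionDecay.lean`.  There the truncated
expectation `𝓔ᵀ(W) = ursellOf (moment c G) W` of the balanced monomials of the clusters (the
Ursell function of the determinant moments of the propagator matrix `G`, Brydges–Battle–Federbush
formula, Benfatto–Giuliani–Mastropietro 2006 (2.66)) was bounded for a propagator given in GRAM FORM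
`G f f' = ⟪A f, B f'⟫` with unit Gram vectors — the form needed for bounds uniform in the order.
At FIXED order no Gram representation is needed: any matrix is in Gram form with the coordinate
vectors against its columns, and the column norms are at most `√|F| · sup|G|`.  PROVED here:

* `moment_smul`, `ursellOf_moment_smul` — **homogeneity**: `𝓔ᵀ_{rG}(W) = r^{#fields(W)} 𝓔ᵀ_G(W)`
  (uniqueness of the Möbius inversion, `UrsellInversion.eq_ursellOf_of_forall`);
* `gramProp_coord` — `G = gramProp (coordinate vectors) (columns)`;
* **`norm_ursellOf_moment_le_lineBound`** — for every matrix `G` with `|G f f'| ≤ C₀` and a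
  cluster-type line bound `|G f f'| ≤ M {c f, c f'}`, every root `v` and at most `n` field pairs per
  cluster,
  `‖𝓔ᵀ(univ)‖ ≤ C₁^{|F|} Σ_{T ∈ lineSets v univ} ∏_{ℓ ∈ T} (2 n² M_ℓ / C₁)`, `C₁ = √|F| C₀`
  (the anchored cluster trees `T` of `BattleFederbushTrees.lineSets`): the sum over connected
  structures of the product of the propagator bounds along a spanning tree, with all constants
  depending on the number of fields only — the input of the termwise (order-by-order) thermodynamic
  limit of the perturbative coefficients;
* `Script.apply_y_le_of_lines`, `Script.exists_line_lt_of_lt_apply_y` — the **long-line lemma**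
  for scripts: if a "potential" `D` on the clusters increases by at most `λ` across every line of
  a script with `k` lines, then `D ≤ D(root) + k λ` at every point of the script; so a point at
  potential `> D(root) + kλ` forces a line across which `D` jumps by more than `λ` (a long line,
  when `D` is the distance from the root) — the mechanism of the domination in the thermodynamic
  limit of the fixed-order coefficients.

## Sources

G. Benfatto, A. Giuliani, V. Mastropietro, Ann. Henri Poincaré 7 (2006), (2.66) and the proof of
(2.77) (`BenfattoGiulianiMastropietro2006`); V. Mastropietro, *Non-Perturbative Renormalization*
(2008), §2.9–2.10 (`Mastropietro2008`); D. C. Brydges, Les Houches 1984, §3 (`Brydges1986`).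
Everything is proved; no named fact.
-/

noncomputable section

open Matrix Finset
open Literature.Probability.LatticeModels Literature.Probability.LatticeModels.BattleFederbush
open scoped InnerProductSpace

namespace Literature.MathematicalPhysics.QuantumLattice

namespace FermionicTree

/-! ### Homogeneity of the truncated expectation in the propagator -/

section Homogeneity

variable {ι : Type*} [DecidableEq ι] {F : Type*} [Fintype F] [LinearOrder F] {R : Type*} [CommRing R]
variable (c : F → ι) (G : Matrix F F R)

/-- The fields of a set partition of `V` partition the fields of `V` (cardinalities). [folklore] -/
theorem sum_card_fieldsOf {V : Finset ι} {π : Finset (Finset ι)} (h : IsSetPartition V π) :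
    ∑ P ∈ π, (fieldsOf c P).card = (fieldsOf c V).card := by
  have hU : fieldsOf c V = π.biUnion (fieldsOf c) := by
    ext a
    simp only [mem_fieldsOf, Finset.mem_biUnion]
    exact ⟨fun ha => h.exists_mem ha, fun ⟨P, hP, ha⟩ => h.subset hP ha⟩
  rw [hU, Finset.card_biUnion]
  intro P hP Q hQ hne
  exact Finset.disjoint_left.2 fun a haP haQ =>
    (Finset.disjoint_left.1 (h.disjoint hP hQ hne)) ((mem_fieldsOf c).1 haP) ((mem_fieldsOf c).1 haQ)

/-- **Homogeneity of the moments**: `moment (r • G) Q = r^{#fields(Q)} moment G Q`. [folklore] -/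
theorem moment_smul (r : R) (Q : Finset ι) :
    moment c (r • G) Q = r ^ (fieldsOf c Q).card * moment c G Q := by
  unfold moment
  rw [Matrix.submatrix_smul, Pi.smul_apply, Pi.smul_apply, Matrix.det_smul, Fintype.card_fin]

/-- **Homogeneity of the truncated expectation**: `𝓔ᵀ_{rG}(V) = r^{#fields(V)} 𝓔ᵀ_G(V)` for
nonempty `V` (both sides satisfy the cluster decomposition of the moments of `r • G`; uniqueness of
the Möbius inversion). [folklore] -/
theorem ursellOf_moment_smul (r : R) {V : Finset ι} (hV : V.Nonempty) :
    ursellOf (moment c (r • G)) V = r ^ (fieldsOf c V).card * ursellOf (moment c G) V := by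
  symm
  refine eq_ursellOf_of_forall (moment c (r • G))
    (fun P => r ^ (fieldsOf c P).card * ursellOf (moment c G) P) (fun W hW => ?_) hV
  rw [moment_smul, ← sum_setPartitions_prod_ursellOf (moment c G) hW, Finset.mul_sum]
  refine Finset.sum_congr rfl fun π hπ => ?_
  rw [Finset.prod_mul_distrib, Finset.prod_pow_eq_pow_sum, sum_card_fieldsOf c (mem_setPartitions.1 hπ)]

end Homogeneity

/-! ### Every matrix is in Gram form -/

section Coord

variable {𝕜 : Type*} [RCLike 𝕜] {F : Type*} [Fintype F] [DecidableEq F]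

/-- The coordinate Gram vectors: rows ↦ `e_f`. [folklore] -/
def coordVec (f : F) : EuclideanSpace 𝕜 F := EuclideanSpace.single f 1

/-- The column Gram vectors: `f' ↦` the `f'`-th column of `G`. [folklore] -/
def colVec (G : Matrix F F 𝕜) (f' : F) : EuclideanSpace 𝕜 F := WithLp.toLp 2 fun f => G f f'

/-- `⟪e_f, col_{f'}(G)⟫ = G f f'`. [folklore] -/
@[simp] theorem inner_coordVec_colVec (G : Matrix F F 𝕜) (f f' : F) :
    ⟪coordVec (𝕜 := 𝕜) f, colVec G f'⟫_𝕜 = G f f' := by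
  rw [coordVec, colVec, EuclideanSpace.inner_single_left, map_one, one_mul]

/-- `‖e_f‖ = 1`. [folklore] -/
theorem norm_coordVec (f : F) : ‖coordVec (𝕜 := 𝕜) f‖ = 1 := by
  rw [coordVec, EuclideanSpace.single, PiLp.norm_single, norm_one]

omit [DecidableEq F] in
/-- `‖col_{f'}(G)‖ ≤ √|F| · C₀` when `|G f f'| ≤ C₀`. [folklore] -/
theorem norm_colVec_le (G : Matrix F F 𝕜) {C₀ : ℝ} (hC₀ : 0 ≤ C₀) (hG : ∀ f f', ‖G f f'‖ ≤ C₀) (f' : F) :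
    ‖colVec G f'‖ ≤ Real.sqrt (Fintype.card F) * C₀ := by
  rw [colVec, EuclideanSpace.norm_eq]
  have hsum : ∑ f, ‖G f f'‖ ^ 2 ≤ Fintype.card F * C₀ ^ 2 := by
    calc ∑ f, ‖G f f'‖ ^ 2 ≤ ∑ _f : F, C₀ ^ 2 :=
          Finset.sum_le_sum fun f _ => pow_le_pow_left₀ (norm_nonneg _) (hG f f') 2
      _ = Fintype.card F * C₀ ^ 2 := by rw [Finset.sum_const, nsmul_eq_mul, Finset.card_univ]
  calc Real.sqrt (∑ f, ‖G f f'‖ ^ 2) ≤ Real.sqrt (Fintype.card F * C₀ ^ 2) := Real.sqrt_le_sqrt hsum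
    _ = Real.sqrt (Fintype.card F) * C₀ := by
        rw [Real.sqrt_mul (Nat.cast_nonneg _), Real.sqrt_sq hC₀]

/-- **Every matrix is in Gram form**: `G = gramProp (e_·) (col_·(G))`. [folklore] -/
theorem gramProp_coord (G : Matrix F F 𝕜) : gramProp 𝕜 (coordVec (𝕜 := 𝕜)) (colVec G) = G := by
  ext f f'
  rw [gramProp, Matrix.of_apply, inner_coordVec_colVec]

end Coord

/-! ### The pointwise tree bound for a bounded propagator -/

section Pointwise

variable {𝕜 : Type*} [RCLike 𝕜]
variable {ι : Type*} [Fintype ι] [DecidableEq ι] {F : Type*} [Fintype F] [LinearOrder F]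
variable (c : F → ι)

/-- **The tree bound at fixed order, for an arbitrary bounded propagator.** Let `G` be any
propagator matrix with `|G f f'| ≤ C₀` (`C₀ > 0`) and a cluster-type line bound
`|G f f'| ≤ M {c f, c f'}` (`M ≥ 0`), at most `n` field pairs per cluster, `v` any cluster. Then,
with `C₁ = √|F| · C₀`,
`‖𝓔ᵀ(univ)‖ ≤ C₁^{|F|} · Σ_{T ∈ lineSets v univ} ∏_{ℓ ∈ T} (2 n² M_ℓ / C₁)`:
rescale `G = C₁ • G'` (`ursellOf_moment_smul`), write `G'` in Gram form with the coordinate vectors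
against the columns divided by `C₁` (all of norm `≤ 1`, `gramProp_coord`), and apply the tree form
of the BBF bound (`norm_ursellOf_moment_le_sum_lineSets`) with the recursive Gram bound estimated
line by line (`assignBound_le_prod`). All constants depend on the number of fields only (no
uniformity in the order is claimed); this is the input of order-by-order estimates.
[cite: BenfattoGiulianiMastropietro2006, (2.66)-(2.77)] -/
theorem norm_ursellOf_moment_le_lineBound [Nonempty F] (G : Matrix F F 𝕜) {C₀ : ℝ} (hC₀ : 0 < C₀)
    (hG0 : ∀ f f', ‖G f f'‖ ≤ C₀) (M : Sym2 ι → ℝ) (hM0 : ∀ ℓ, 0 ≤ M ℓ)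
    (hGM : ∀ f f', ‖G f f'‖ ≤ M s(c f, c f')) (n : ℕ) (hn : ∀ x : ι, (fieldsOf c {x}).card ≤ n)
    (v : ι) :
    ‖ursellOf (moment c G) univ‖ ≤
      (Real.sqrt (Fintype.card F) * C₀) ^ Fintype.card F *
        ∑ T ∈ lineSets v (univ : Finset ι), ∏ ℓ ∈ T, (2 * (n : ℝ) ^ 2 * (M ℓ / (Real.sqrt (Fintype.card F) * C₀))) := by
  classical
  set C₁ : ℝ := Real.sqrt (Fintype.card F) * C₀ with hC₁
  have hcard : 0 < Fintype.card F := Fintype.card_pos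
  have hC₁pos : 0 < C₁ := mul_pos (Real.sqrt_pos.2 (by exact_mod_cast hcard)) hC₀
  -- the rescaled propagator in Gram form with vectors of norm ≤ 1
  set A : F → EuclideanSpace 𝕜 F := coordVec (𝕜 := 𝕜) with hA
  set B : F → EuclideanSpace 𝕜 F := fun f' => ((C₁⁻¹ : ℝ) : 𝕜) • colVec G f' with hB
  have hGram : G = ((C₁ : ℝ) : 𝕜) • gramProp 𝕜 A B := by
    ext f f'
    rw [Matrix.smul_apply, gramProp, Matrix.of_apply, hB, inner_smul_right, hA, inner_coordVec_colVec,
      smul_eq_mul, ← mul_assoc, ← RCLike.ofReal_mul, mul_inv_cancel₀ hC₁pos.ne', RCLike.ofReal_one, one_mul]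
  have hAn : ∀ a, ‖A a‖ ≤ 1 := fun a => by rw [hA, norm_coordVec]
  have hBn : ∀ b, ‖B b‖ ≤ 1 := fun b => by
    rw [hB, norm_smul, RCLike.norm_ofReal, abs_of_pos (inv_pos.2 hC₁pos)]
    calc C₁⁻¹ * ‖colVec G b‖ ≤ C₁⁻¹ * C₁ :=
          mul_le_mul_of_nonneg_left (norm_colVec_le G hC₀.le hG0 b) (inv_nonneg.2 hC₁pos.le)
      _ = 1 := inv_mul_cancel₀ hC₁pos.ne'
  -- the entries of the rescaled Gram matrix
  have hinner : ∀ a b, ‖(⟪A a, B b⟫_𝕜 : 𝕜)‖ = ‖G a b‖ / C₁ := fun a b => by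
    rw [hB, inner_smul_right, hA, inner_coordVec_colVec, norm_mul, RCLike.norm_ofReal,
      abs_of_pos (inv_pos.2 hC₁pos), div_eq_inv_mul]
  -- homogeneity
  have hfields : (fieldsOf c (univ : Finset ι)).card = Fintype.card F := by
    rw [fieldsOf, Finset.filter_true_of_mem fun a _ => mem_univ _, Finset.card_univ]
  have huniv : (univ : Finset ι).Nonempty := ⟨v, mem_univ v⟩
  rw [hGram, ursellOf_moment_smul c _ _ huniv, norm_mul, norm_pow, RCLike.norm_ofReal,
    abs_of_pos hC₁pos, hfields]
  refine mul_le_mul_of_nonneg_left ?_ (pow_nonneg hC₁pos.le _)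
  -- the BBF tree bound with the line-by-line estimate of the recursive Gram bound
  refine (norm_ursellOf_moment_le_sum_lineSets c A B univ (mem_univ v)).trans (sum_le_sum fun T hT => ?_)
  obtain ⟨k, -, s, hs, -, rfl⟩ := mem_lineSets.1 hT
  rw [← assignBound_lines_eq_treeBound c A B s hs univ, List.prod_toFinset _ (Script.nodup_lines s hs)]
  refine assignBound_le_prod c A B (enum c univ) (fun a => hAn _) (fun b => hBn _) (fun ℓ => M ℓ / C₁)
    (fun ℓ => div_nonneg (hM0 ℓ) hC₁pos.le) (fun a b => ?_) n
    (fun x => (card_filter_enum_le c univ x).trans (hn x)) s.lines ∅ id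
  rw [hinner]
  exact div_le_div_of_nonneg_right (hGM _ _) hC₁pos.le

end Pointwise

end FermionicTree

end Literature.MathematicalPhysics.QuantumLattice

/-! ### The long-line lemma for scripts -/

namespace Literature.Probability.LatticeModels.BattleFederbush.Script

variable {ι : Type*} {root : ι}

/-- **A potential with bounded jumps along the lines grows at most linearly along a script**: if
`D w ≤ D u + λ` for every line `{u, w}` of the script `s` (with `k` lines, in either orientation)
then `D(y_m) ≤ D(root) + k λ` for every point `y_m` of `s`. Contrapositively, a point at potential
`> D(root) + k λ` forces a line across which `D` jumps by more than `λ` — a LONG line when `D` is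
a distance from the root and the jump across a line is at most its length. [folklore] -/
theorem apply_y_le_of_lines (D : ι → ℝ) {lam : ℝ} (hlam : 0 ≤ lam) :
    ∀ {k : ℕ} (s : Script root k), (∀ ℓ ∈ s.lines, ∀ u ∈ ℓ, ∀ w ∈ ℓ, D w ≤ D u + lam) →
      ∀ m : Fin (k + 1), D (s.y m) ≤ D root + k * lam
  | _, nil, _, m => by simp [y]
  | k + 1, snoc s i z, h, m => by
    have hs : ∀ ℓ ∈ s.lines, ∀ u ∈ ℓ, ∀ w ∈ ℓ, D w ≤ D u + lam := fun ℓ hℓ =>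
      h ℓ (by rw [lines, List.mem_append]; exact Or.inl hℓ)
    induction m using Fin.lastCases with
    | last =>
      rw [y_snoc_last]
      have hz := h s(s.y i, z) (by rw [lines, List.mem_append]; exact Or.inr (List.mem_singleton_self _))
        (s.y i) (Sym2.mem_mk_left _ _) z (Sym2.mem_mk_right _ _)
      have ih := apply_y_le_of_lines D hlam s hs i
      push_cast
      linarith
    | cast m =>
      rw [y_snoc_castSucc]
      have ih := apply_y_le_of_lines D hlam s hs m
      push_cast
      linarith

/-- **The long-line lemma**: if some point of a script with `k` lines has potential
`D(y_m) > D(root) + k λ`, then some line `{u, w}` of the script has `D w > D u + λ`. [folklore] -/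
theorem exists_line_lt_of_lt_apply_y (D : ι → ℝ) {lam : ℝ} (hlam : 0 ≤ lam) {k : ℕ} (s : Script root k)
    {m : Fin (k + 1)} (hm : D root + k * lam < D (s.y m)) :
    ∃ ℓ ∈ s.lines, ∃ u ∈ ℓ, ∃ w ∈ ℓ, D u + lam < D w := by
  by_contra hcon
  push Not at hcon
  exact (apply_y_le_of_lines D hlam s hcon m).not_gt hm

end Literature.Probability.LatticeModels.BattleFederbush.Script

end
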